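import Mathlib
import Summits.ValiantsHypothesis.ValiantsHypothesis.Theorems.RigidityForcesSymmetryRankRigidMinimalReprLaplaceFiveTilingsFamilies
import Summits.ValiantsHypothesis.ValiantsHypothesis.Theorems.RigidityForcesSymmetryRankRigidMinimalReprLaplaceFiveSectorSplitDefs
import Summits.ValiantsHypothesis.ValiantsHypothesis.Theorems.RigidityForcesSymmetryRankRigidMinimalReprLaplaceFiveFourSplitSlackDefs

/-!
# Young-shadow SLACK on four pair splits: separation FAILS on `K₁,₄`, `C₄`, `K₃ ⊔ K₂` — explicit relation tensors
# (crux `RankRigidMinimalRepr`, stmt-ValiantsHypothesis-18034; frontier rung `LaplaceOptimalFive`, stmt-24813; line `shallow_collision`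
#  rev 4, stub S2′ `stub_sideSym_offShell_five` = young-shadow K1; director-valiant g16 R286 (1)(ii))

CENSUS (exact rank over `ℚ`, all `126` letter contents × all `210` quadruples of distinct pair splits; `work/explore/foursplit.py`
of the seat, numbers re-derivable in minutes): the space of quadruples `(Z₁, …, Z₄)`, `Z_k` symmetric within both sides of `S_k`,
with `Σ Z_k` fully symmetric, MODULO the fully symmetric quadruples, has dimension `0` for the `180` rigid supports (`P₅`, paw,
chair — separated in `…LaplaceFiveFourSplitTypes`, val-lit-p4 g14) and, on the injective words / on all words,
`5 / 175` for the `5` stars `K₁,₄`, `4 / 224` for the `15` four-cycles `C₄`, `9 / 399` for the `10` supports `K₃ ⊔ K₂`.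
The injective-word slack is the relation space of the Young-invariant lines: `Σ_j ξ³²_{0j} = 0` (star), `Σ ± ξ⁴¹` around `C₄`,
`ξ⁴¹₀₁ + ξ⁴¹₀₂ + ξ⁴¹₁₂ + 2 ξ⁴¹₃₄ = 0` and `ξ³²₀₁ + ξ³²₀₂ + ξ³²₁₂ − ξ³²₃₄ = 0` (`K₃ ⊔ K₂`).  This file writes these four relations
as explicit tensors (`…FourSplitSlackDefs`: `edgePent`, `edgePot`) and proves:

* `edge_sideSym` — `v ↦ [v injective] · g (v p) (v q)` is symmetric within both sides of `{p, q}` for symmetric `g`;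
* `star_slack`, `cycle_slack`, `triangleEdge_slack₄₁`, `triangleEdge_slack₃₂` — the four relations: side-symmetric summands, fully
  symmetric (indeed constant multiples of `[v injective]`) sum, and a NON-symmetric summand;
* `not_fourSplit_separation_star / _cycle / _triangleEdge` — **four-split separation is FALSE on the three slack supports**: the
  «shadows are fully symmetric ⇒ catalecticant» mechanism of Prop A (`LaplaceFivePropA.sideSym_threePairSplits`) stops exactly
  here; these relation tensors are the first objects a proof of S2′ on slack supports has to price.

HONEST FRAMING: negative calibration lemmas; `LaplaceOptimalFive` (stmt-24813) stays OPEN · CONTESTED 72/120; nothing here bears on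
`VP ≠ VNP`, which is NOT proved.
-/

set_option autoImplicit false

-- the mandated summit-side namespace repeats a component by design (single-problem summit)
set_option linter.dupNamespace false

namespace Summit.ValiantsHypothesis.ValiantsHypothesis.Theorems.RigidityForcesSymmetryRankRigidMinimalRepr

namespace LaplaceFiveSectorSplit

open Finset
open LaplaceFiveTilings (perms5 mem_perms5)

/-! ### §1 Side-symmetry of the building blocks -/

/-- The injective-word indicator is invariant under slot permutations. -/
theorem injC_comp_perm (v : Fin 5 → Fin 5) (τ : Equiv.Perm (Fin 5)) : injC (v ∘ ⇑τ) = injC v := by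
  unfold injC
  have h : Function.Injective (v ∘ ⇑τ) ↔ Function.Injective v := by
    refine ⟨fun hi => ?_, fun hi => hi.comp τ.injective⟩
    have h2 := hi.comp τ.symm.injective
    have e : (v ∘ ⇑τ) ∘ ⇑τ.symm = v := by funext i; simp
    rwa [e] at h2
  simp only [h]

/-- A slot permutation fixing the complement of `{p, q}` pointwise fixes or exchanges `p` and `q`. -/
theorem perm_fix_compl_pair {p q : Fin 5} (hpq : p ≠ q) (τ : Equiv.Perm (Fin 5))
    (hτ : ∀ i, i ∉ ({p, q} : Finset (Fin 5)) → τ i = i) : (τ p = p ∧ τ q = q) ∨ (τ p = q ∧ τ q = p) := by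
  have key : ∀ x ∈ ({p, q} : Finset (Fin 5)), τ x ∈ ({p, q} : Finset (Fin 5)) := by
    intro x hx
    by_contra hno
    have h1 : τ (τ x) = τ x := hτ _ hno
    have h2 : τ x = x := τ.injective h1
    exact hno (by rw [h2]; exact hx)
  have hp := key p (by simp)
  have hq := key q (by simp)
  simp only [Finset.mem_insert, Finset.mem_singleton] at hp hq
  have hne : τ p ≠ τ q := fun h => hpq (τ.injective h)
  rcases hp with hp | hp <;> rcases hq with hq | hq
  · exact absurd (hp.trans hq.symm) hne
  · exact Or.inl ⟨hp, hq⟩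
  · exact Or.inr ⟨hp, hq⟩
  · exact absurd (hp.trans hq.symm) hne

/-- **`v ↦ [v injective] · g (v p) (v q)` is symmetric within both sides of the pair split `{p, q}`** (for symmetric `g`). -/
theorem edge_sideSym (g : Fin 5 → Fin 5 → ℂ) (hg : ∀ a b, g a b = g b a) {p q : Fin 5} (hpq : p ≠ q) :
    SlotInvariantOn ({p, q} : Finset (Fin 5)) (fun v => injC v * g (v p) (v q)) ∧
    SlotInvariantOn ({p, q} : Finset (Fin 5))ᶜ (fun v => injC v * g (v p) (v q)) := by
  constructor
  · intro τ hτ v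
    show injC (v ∘ ⇑τ) * g ((v ∘ ⇑τ) p) ((v ∘ ⇑τ) q) = injC v * g (v p) (v q)
    rw [injC_comp_perm]
    rcases perm_fix_compl_pair hpq τ hτ with ⟨hp, hq⟩ | ⟨hp, hq⟩
    · simp only [Function.comp, hp, hq]
    · simp only [Function.comp, hp, hq, hg (v q) (v p)]
  · intro τ hτ v
    have hp : τ p = p := hτ p (by simp)
    have hq : τ q = q := hτ q (by simp [hpq.symm])
    show injC (v ∘ ⇑τ) * g ((v ∘ ⇑τ) p) ((v ∘ ⇑τ) q) = injC v * g (v p) (v q)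
    rw [injC_comp_perm]
    simp only [Function.comp, hp, hq]

/-- `pent` is symmetric. -/
theorem pent_symm : ∀ a b : Fin 5, pent a b = pent b a := by decide

/-- Side-symmetry of `edgePent p q`. -/
theorem edgePent_sideSym {p q : Fin 5} (hpq : p ≠ q) :
    SlotInvariantOn ({p, q} : Finset (Fin 5)) (edgePent p q) ∧ SlotInvariantOn ({p, q} : Finset (Fin 5))ᶜ (edgePent p q) :=
  edge_sideSym (fun a b => (pent a b : ℂ)) (fun a b => by rw [pent_symm]) hpq

/-- Side-symmetry of `edgePot p q`. -/
theorem edgePot_sideSym {p q : Fin 5} (hpq : p ≠ q) :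
    SlotInvariantOn ({p, q} : Finset (Fin 5)) (edgePot p q) ∧ SlotInvariantOn ({p, q} : Finset (Fin 5))ᶜ (edgePot p q) :=
  edge_sideSym (fun a b => (ind0 a : ℂ) + (ind0 b : ℂ)) (fun _ _ => add_comm _ _) hpq

/-- The injective-word indicator is fully symmetric, and so is any constant multiple. -/
theorem injC_mul_univ (c : ℂ) : SlotInvariantOn Finset.univ (fun v => c * injC v) :=
  fun τ _ v => by show c * injC (v ∘ ⇑τ) = c * injC v; rw [injC_comp_perm]

/-! ### §2 Kernel identities on the `120` permutation words -/

/-- Kernel certificate (Bool form over the listed permutation words) of the three relations below. -/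
theorem slack_identities_cert :
    (perms5.all fun v => (pent (v 0) (v 1) + pent (v 0) (v 2) + pent (v 0) (v 3) + pent (v 0) (v 4) == 0) &&
      (pent (v 0) (v 1) + pent (v 0) (v 2) + pent (v 1) (v 2) - pent (v 3) (v 4) == 0) &&
      ((ind0 (v 0) + ind0 (v 1)) + (ind0 (v 0) + ind0 (v 2)) + (ind0 (v 1) + ind0 (v 2)) + 2 * (ind0 (v 3) + ind0 (v 4)) == 2))
      = true := by
  decide +kernel

/-- Star relation: the `pent`-values of the four edges at a letter sum to `0`. -/
theorem star_identity : ∀ v ∈ perms5, pent (v 0) (v 1) + pent (v 0) (v 2) + pent (v 0) (v 3) + pent (v 0) (v 4) = 0 := by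
  intro v hv
  have h := List.all_eq_true.1 slack_identities_cert v hv
  simp only [Bool.and_eq_true, beq_iff_eq] at h
  exact h.1.1

/-- `K₃ ⊔ K₂` relation of type `(3,2)`: triangle sum of `pent` equals its value on the opposite edge. -/
theorem triangleEdge_identity₃₂ : ∀ v ∈ perms5,
    pent (v 0) (v 1) + pent (v 0) (v 2) + pent (v 1) (v 2) - pent (v 3) (v 4) = 0 := by
  intro v hv
  have h := List.all_eq_true.1 slack_identities_cert v hv
  simp only [Bool.and_eq_true, beq_iff_eq] at h
  exact h.1.2

/-- `K₃ ⊔ K₂` relation of type `(4,1)`: with weights `(1,1,1,2)` the potentials add up to twice the total potential. -/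
theorem triangleEdge_identity₄₁ : ∀ v ∈ perms5,
    (ind0 (v 0) + ind0 (v 1)) + (ind0 (v 0) + ind0 (v 2)) + (ind0 (v 1) + ind0 (v 2)) + 2 * (ind0 (v 3) + ind0 (v 4)) = 2 := by
  intro v hv
  have h := List.all_eq_true.1 slack_identities_cert v hv
  simp only [Bool.and_eq_true, beq_iff_eq] at h
  exact h.2

/-! ### §3 The three slack supports -/

/-- Non-symmetry witness for `edgePent 0 1`: the slot swap `(1 2)` changes its value at the identity word. -/
theorem edgePent01_not_univ : ¬ SlotInvariantOn Finset.univ (edgePent 0 1) := by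
  intro h
  have h1 := h (Equiv.swap 1 2) (fun i hi => absurd (Finset.mem_univ i) hi) id
  have e1 : (id : Fin 5 → Fin 5) ∘ ⇑(Equiv.swap (1 : Fin 5) 2) = ⇑(Equiv.swap (1 : Fin 5) 2) := rfl
  rw [e1] at h1
  unfold edgePent injC at h1
  rw [if_pos (Equiv.injective _), if_pos Function.injective_id] at h1
  have e2 : pent ((Equiv.swap (1 : Fin 5) 2) 0) ((Equiv.swap (1 : Fin 5) 2) 1) = -1 := by decide
  have e3 : pent ((id : Fin 5 → Fin 5) 0) ((id : Fin 5 → Fin 5) 1) = 1 := by decide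
  rw [e2, e3] at h1
  norm_num at h1

/-- Non-symmetry witness for `edgePot 0 1`: the slot swap `(0 2)` changes its value at the identity word. -/
theorem edgePot01_not_univ : ¬ SlotInvariantOn Finset.univ (edgePot 0 1) := by
  intro h
  have h1 := h (Equiv.swap 0 2) (fun i hi => absurd (Finset.mem_univ i) hi) id
  have e1 : (id : Fin 5 → Fin 5) ∘ ⇑(Equiv.swap (0 : Fin 5) 2) = ⇑(Equiv.swap (0 : Fin 5) 2) := rfl
  rw [e1] at h1
  unfold edgePot injC at h1
  rw [if_pos (Equiv.injective _), if_pos Function.injective_id] at h1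
  have e2 : ind0 ((Equiv.swap (0 : Fin 5) 2) 0) = 0 := by decide
  have e3 : ind0 ((Equiv.swap (0 : Fin 5) 2) 1) = 0 := by decide
  have e4 : ind0 ((id : Fin 5 → Fin 5) 0) = 1 := by decide
  have e5 : ind0 ((id : Fin 5 → Fin 5) 1) = 0 := by decide
  rw [e2, e3, e4, e5] at h1
  norm_num at h1

/-- **STAR SLACK** (`K₁,₄ = {01,02,03,04}`, relation `Σ_j ξ³²_{0j} = 0`): the four tensors `edgePent 0 j` are side-symmetric for
`{0, j}`, their sum is `0` (fully symmetric), and `edgePent 0 1` is not fully symmetric. -/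
theorem star_slack :
    (SlotInvariantOn ({0, 1} : Finset (Fin 5)) (edgePent 0 1) ∧ SlotInvariantOn ({0, 1} : Finset (Fin 5))ᶜ (edgePent 0 1)) ∧
    (SlotInvariantOn ({0, 2} : Finset (Fin 5)) (edgePent 0 2) ∧ SlotInvariantOn ({0, 2} : Finset (Fin 5))ᶜ (edgePent 0 2)) ∧
    (SlotInvariantOn ({0, 3} : Finset (Fin 5)) (edgePent 0 3) ∧ SlotInvariantOn ({0, 3} : Finset (Fin 5))ᶜ (edgePent 0 3)) ∧
    (SlotInvariantOn ({0, 4} : Finset (Fin 5)) (edgePent 0 4) ∧ SlotInvariantOn ({0, 4} : Finset (Fin 5))ᶜ (edgePent 0 4)) ∧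
    edgePent 0 1 + edgePent 0 2 + edgePent 0 3 + edgePent 0 4 = 0 ∧
    ¬ SlotInvariantOn Finset.univ (edgePent 0 1) := by
  refine ⟨edgePent_sideSym (by decide), edgePent_sideSym (by decide), edgePent_sideSym (by decide),
    edgePent_sideSym (by decide), ?_, edgePent01_not_univ⟩
  funext v
  simp only [Pi.add_apply, Pi.zero_apply, edgePent, injC]
  by_cases hv : Function.Injective v
  · have h := star_identity v (mem_perms5 hv)
    have h' : (pent (v 0) (v 1) : ℂ) + pent (v 0) (v 2) + pent (v 0) (v 3) + pent (v 0) (v 4) = 0 := by exact_mod_cast h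
    rw [if_pos hv]
    linear_combination h'
  · rw [if_neg hv]; ring

/-- **FOUR-CYCLE SLACK** (`C₄ = {01,12,23,30}`, relation `ξ⁴¹₀₁ − ξ⁴¹₁₂ + ξ⁴¹₂₃ − ξ⁴¹₃₀ = 0`): alternating potentials around the
cycle are side-symmetric, sum to `0`, and `edgePot 0 1` is not fully symmetric. -/
theorem cycle_slack :
    (SlotInvariantOn ({0, 1} : Finset (Fin 5)) (edgePot 0 1) ∧ SlotInvariantOn ({0, 1} : Finset (Fin 5))ᶜ (edgePot 0 1)) ∧
    (SlotInvariantOn ({1, 2} : Finset (Fin 5)) (-edgePot 1 2) ∧ SlotInvariantOn ({1, 2} : Finset (Fin 5))ᶜ (-edgePot 1 2)) ∧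
    (SlotInvariantOn ({2, 3} : Finset (Fin 5)) (edgePot 2 3) ∧ SlotInvariantOn ({2, 3} : Finset (Fin 5))ᶜ (edgePot 2 3)) ∧
    (SlotInvariantOn ({3, 0} : Finset (Fin 5)) (-edgePot 3 0) ∧ SlotInvariantOn ({3, 0} : Finset (Fin 5))ᶜ (-edgePot 3 0)) ∧
    edgePot 0 1 + -edgePot 1 2 + edgePot 2 3 + -edgePot 3 0 = 0 ∧
    ¬ SlotInvariantOn Finset.univ (edgePot 0 1) := by
  have neg : ∀ (A : Finset (Fin 5)) (T : (Fin 5 → Fin 5) → ℂ), SlotInvariantOn A T → SlotInvariantOn A (-T) :=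
    fun A T h τ hτ v => by simp only [Pi.neg_apply, h τ hτ v]
  refine ⟨edgePot_sideSym (by decide), ⟨neg _ _ (edgePot_sideSym (by decide)).1, neg _ _ (edgePot_sideSym (by decide)).2⟩,
    edgePot_sideSym (by decide), ⟨neg _ _ (edgePot_sideSym (by decide)).1, neg _ _ (edgePot_sideSym (by decide)).2⟩, ?_,
    edgePot01_not_univ⟩
  funext v
  simp only [Pi.add_apply, Pi.neg_apply, Pi.zero_apply, edgePot]
  ring

/-- **`K₃ ⊔ K₂` SLACK of type `(4,1)`** (`{01,02,12,34}`, relation `ξ⁴¹₀₁ + ξ⁴¹₀₂ + ξ⁴¹₁₂ + 2ξ⁴¹₃₄ = 0`): the weighted potentials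
are side-symmetric, their sum is the fully symmetric tensor `2·[v injective]`, and `edgePot 0 1` is not fully symmetric. -/
theorem triangleEdge_slack₄₁ :
    (SlotInvariantOn ({0, 1} : Finset (Fin 5)) (edgePot 0 1) ∧ SlotInvariantOn ({0, 1} : Finset (Fin 5))ᶜ (edgePot 0 1)) ∧
    (SlotInvariantOn ({0, 2} : Finset (Fin 5)) (edgePot 0 2) ∧ SlotInvariantOn ({0, 2} : Finset (Fin 5))ᶜ (edgePot 0 2)) ∧
    (SlotInvariantOn ({1, 2} : Finset (Fin 5)) (edgePot 1 2) ∧ SlotInvariantOn ({1, 2} : Finset (Fin 5))ᶜ (edgePot 1 2)) ∧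
    (SlotInvariantOn ({3, 4} : Finset (Fin 5)) ((2 : ℂ) • edgePot 3 4) ∧
      SlotInvariantOn ({3, 4} : Finset (Fin 5))ᶜ ((2 : ℂ) • edgePot 3 4)) ∧
    SlotInvariantOn Finset.univ (edgePot 0 1 + edgePot 0 2 + edgePot 1 2 + (2 : ℂ) • edgePot 3 4) ∧
    ¬ SlotInvariantOn Finset.univ (edgePot 0 1) := by
  have smul : ∀ (A : Finset (Fin 5)) (T : (Fin 5 → Fin 5) → ℂ), SlotInvariantOn A T → SlotInvariantOn A ((2 : ℂ) • T) :=
    fun A T h τ hτ v => by simp only [Pi.smul_apply, smul_eq_mul, h τ hτ v]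
  refine ⟨edgePot_sideSym (by decide), edgePot_sideSym (by decide), edgePot_sideSym (by decide),
    ⟨smul _ _ (edgePot_sideSym (by decide)).1, smul _ _ (edgePot_sideSym (by decide)).2⟩, ?_, edgePot01_not_univ⟩
  have hsum : edgePot 0 1 + edgePot 0 2 + edgePot 1 2 + (2 : ℂ) • edgePot 3 4 = fun v => 2 * injC v := by
    funext v
    simp only [Pi.add_apply, Pi.smul_apply, smul_eq_mul, edgePot, injC]
    by_cases hv : Function.Injective v
    · have h := triangleEdge_identity₄₁ v (mem_perms5 hv)
      have h' : ((ind0 (v 0) : ℂ) + ind0 (v 1)) + (ind0 (v 0) + ind0 (v 2)) + (ind0 (v 1) + ind0 (v 2)) +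
          2 * (ind0 (v 3) + ind0 (v 4)) = 2 := by exact_mod_cast h
      rw [if_pos hv]
      linear_combination h'
    · rw [if_neg hv]; ring
  rw [hsum]
  exact injC_mul_univ 2

/-- **`K₃ ⊔ K₂` SLACK of type `(3,2)`** (`{01,02,12,34}`, relation `ξ³²₀₁ + ξ³²₀₂ + ξ³²₁₂ − ξ³²₃₄ = 0`): the `pent`-tensors with signs
`(1,1,1,−1)` are side-symmetric, sum to `0`, and `edgePent 0 1` is not fully symmetric. -/
theorem triangleEdge_slack₃₂ :
    (SlotInvariantOn ({0, 1} : Finset (Fin 5)) (edgePent 0 1) ∧ SlotInvariantOn ({0, 1} : Finset (Fin 5))ᶜ (edgePent 0 1)) ∧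
    (SlotInvariantOn ({0, 2} : Finset (Fin 5)) (edgePent 0 2) ∧ SlotInvariantOn ({0, 2} : Finset (Fin 5))ᶜ (edgePent 0 2)) ∧
    (SlotInvariantOn ({1, 2} : Finset (Fin 5)) (edgePent 1 2) ∧ SlotInvariantOn ({1, 2} : Finset (Fin 5))ᶜ (edgePent 1 2)) ∧
    (SlotInvariantOn ({3, 4} : Finset (Fin 5)) (-edgePent 3 4) ∧ SlotInvariantOn ({3, 4} : Finset (Fin 5))ᶜ (-edgePent 3 4)) ∧
    edgePent 0 1 + edgePent 0 2 + edgePent 1 2 + -edgePent 3 4 = 0 ∧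
    ¬ SlotInvariantOn Finset.univ (edgePent 0 1) := by
  have neg : ∀ (A : Finset (Fin 5)) (T : (Fin 5 → Fin 5) → ℂ), SlotInvariantOn A T → SlotInvariantOn A (-T) :=
    fun A T h τ hτ v => by simp only [Pi.neg_apply, h τ hτ v]
  refine ⟨edgePent_sideSym (by decide), edgePent_sideSym (by decide), edgePent_sideSym (by decide),
    ⟨neg _ _ (edgePent_sideSym (by decide)).1, neg _ _ (edgePent_sideSym (by decide)).2⟩, ?_, edgePent01_not_univ⟩
  funext v
  simp only [Pi.add_apply, Pi.neg_apply, Pi.zero_apply, edgePent, injC]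
  by_cases hv : Function.Injective v
  · have h := triangleEdge_identity₃₂ v (mem_perms5 hv)
    have h' : (pent (v 0) (v 1) : ℂ) + pent (v 0) (v 2) + pent (v 1) (v 2) - pent (v 3) (v 4) = 0 := by exact_mod_cast h
    rw [if_pos hv]
    linear_combination h'
  · rw [if_neg hv]; ring

/-! ### §4 Four-split separation fails on the slack supports -/

/-- **Separation FAILS on the star `K₁,₄ = {01,02,03,04}`.** -/
theorem not_fourSplit_separation_star : ¬ ∀ Z₁ Z₂ Z₃ Z₄ : (Fin 5 → Fin 5) → ℂ,
    (SlotInvariantOn ({0, 1} : Finset (Fin 5)) Z₁ ∧ SlotInvariantOn ({0, 1} : Finset (Fin 5))ᶜ Z₁) →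
    (SlotInvariantOn ({0, 2} : Finset (Fin 5)) Z₂ ∧ SlotInvariantOn ({0, 2} : Finset (Fin 5))ᶜ Z₂) →
    (SlotInvariantOn ({0, 3} : Finset (Fin 5)) Z₃ ∧ SlotInvariantOn ({0, 3} : Finset (Fin 5))ᶜ Z₃) →
    (SlotInvariantOn ({0, 4} : Finset (Fin 5)) Z₄ ∧ SlotInvariantOn ({0, 4} : Finset (Fin 5))ᶜ Z₄) →
    SlotInvariantOn Finset.univ (Z₁ + Z₂ + Z₃ + Z₄) → SlotInvariantOn Finset.univ Z₁ := by
  intro h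
  obtain ⟨h1, h2, h3, h4, hs, hn⟩ := star_slack
  refine hn (h _ _ _ _ h1 h2 h3 h4 ?_)
  rw [hs]
  exact fun τ _ v => rfl

/-- **Separation FAILS on the four-cycle `C₄ = {01,12,23,30}`.** -/
theorem not_fourSplit_separation_cycle : ¬ ∀ Z₁ Z₂ Z₃ Z₄ : (Fin 5 → Fin 5) → ℂ,
    (SlotInvariantOn ({0, 1} : Finset (Fin 5)) Z₁ ∧ SlotInvariantOn ({0, 1} : Finset (Fin 5))ᶜ Z₁) →
    (SlotInvariantOn ({1, 2} : Finset (Fin 5)) Z₂ ∧ SlotInvariantOn ({1, 2} : Finset (Fin 5))ᶜ Z₂) →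
    (SlotInvariantOn ({2, 3} : Finset (Fin 5)) Z₃ ∧ SlotInvariantOn ({2, 3} : Finset (Fin 5))ᶜ Z₃) →
    (SlotInvariantOn ({3, 0} : Finset (Fin 5)) Z₄ ∧ SlotInvariantOn ({3, 0} : Finset (Fin 5))ᶜ Z₄) →
    SlotInvariantOn Finset.univ (Z₁ + Z₂ + Z₃ + Z₄) → SlotInvariantOn Finset.univ Z₁ := by
  intro h
  obtain ⟨h1, h2, h3, h4, hs, hn⟩ := cycle_slack
  refine hn (h _ _ _ _ h1 h2 h3 h4 ?_)
  rw [hs]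
  exact fun τ _ v => rfl

/-- **Separation FAILS on `K₃ ⊔ K₂ = {01,02,12,34}`** (two independent relation types; the `(3,2)` one is used here). -/
theorem not_fourSplit_separation_triangleEdge : ¬ ∀ Z₁ Z₂ Z₃ Z₄ : (Fin 5 → Fin 5) → ℂ,
    (SlotInvariantOn ({0, 1} : Finset (Fin 5)) Z₁ ∧ SlotInvariantOn ({0, 1} : Finset (Fin 5))ᶜ Z₁) →
    (SlotInvariantOn ({0, 2} : Finset (Fin 5)) Z₂ ∧ SlotInvariantOn ({0, 2} : Finset (Fin 5))ᶜ Z₂) →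
    (SlotInvariantOn ({1, 2} : Finset (Fin 5)) Z₃ ∧ SlotInvariantOn ({1, 2} : Finset (Fin 5))ᶜ Z₃) →
    (SlotInvariantOn ({3, 4} : Finset (Fin 5)) Z₄ ∧ SlotInvariantOn ({3, 4} : Finset (Fin 5))ᶜ Z₄) →
    SlotInvariantOn Finset.univ (Z₁ + Z₂ + Z₃ + Z₄) → SlotInvariantOn Finset.univ Z₁ := by
  intro h
  obtain ⟨h1, h2, h3, h4, hs, hn⟩ := triangleEdge_slack₃₂
  refine hn (h _ _ _ _ h1 h2 h3 h4 ?_)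
  rw [hs]
  exact fun τ _ v => rfl

end LaplaceFiveSectorSplit

end Summit.ValiantsHypothesis.ValiantsHypothesis.Theorems.RigidityForcesSymmetryRankRigidMinimalRepr
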